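import Literature.Geometry.Lorentzian.KerrTortoiseRadius
import Literature.Geometry.Lorentzian.KerrSeparatedPotential
import Mathlib.Analysis.SpecialFunctions.Sqrt
import Mathlib.Analysis.SpecialFunctions.ExpDeriv
import HarnessLib

/-!
# From the star-chart radial ODE to DRSR's normal form `u'' + (ω² - V) u = H` in `r*`

Dafermos–Rodnianski–Shlapentokh-Rothman, arXiv:1402.7034, §5.2.3, Prop. 5.2.1 and the display
following it (the potential `V = V₀ + V₁`, `Kerr.sepPotential`). The tree's separation of the
wave operator in the coordinates `(t*, r, θ, φ*)` (`Kerr.carter_radial_ode_star`) produces, for a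
mode coefficient `c(r)` with `c' = c₁`, `c₁' = c₂`, the **star-chart radial ODE**
`Δ c₂ + (2(r - M) + 2i(am - 2Mrω)) c₁ + (ω²(r² + 2Mr) - 2iMω - λ) c = G`.
The Boyer–Lindquist coefficient is `R = e^{-iϑ} c` with `ϑ' = (2Mrω - am)/Δ` (the phase relating
`(t*, φ*)`- and `(t, φ)`-modes), and DRSR's unknown is `u = (r² + a²)^{1/2} R` as a function of
the tortoise coordinate, `dr*/dr = (r² + a²)/Δ`. This file performs that substitution:

* `Kerr.nfU a R ϑ c x = √(R x² + a²) e^{-iϑ(R x)} c(R x)` along a tortoise radius function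
  `R = r(x)` (`Kerr.IsTortoiseRadius`), and its first derivative `Kerr.nfU₁` in closed form
  (`hasDerivAt_nfU`);
* **`Kerr.nfU_ode`** (main): if `c, c₁, c₂, G` satisfy the star-chart ODE on an open radial
  interval `S`, then at every `x` with `R x ∈ S`, `u = nfU` satisfies
  `u'' + (ω² - V(ω, m, λ + a²ω²)(R x)) u = H`, with `V = Kerr.sepPotential M a ω m (λ + a²ω²)` and
  `H = Δ e^{-iϑ} G / (r² + a²)^{3/2}` at `r = R x` — DRSR's (36)–(38).

## References

* M. Dafermos, I. Rodnianski, Y. Shlapentokh-Rothman, arXiv:1402.7034, §5.2.3, Prop. 5.2.1 and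
  the display following it. [DafermosRodnianskiShlapentokhrothman2014]
-/

noncomputable section

open Real Set Filter Complex
open scoped Topology

namespace Literature.Geometry.Lorentzian

namespace Kerr

/-! ### The substitution -/

/-- **`u = (r² + a²)^{1/2} e^{-iϑ} c`** read along a tortoise radius function `R`.
[cite: DafermosRodnianskiShlapentokhrothman2014, §5.2.3 (37)] -/
def nfU (a : ℝ) (R ϑ : ℝ → ℝ) (c : ℝ → ℂ) (x : ℝ) : ℂ :=
  (Real.sqrt (R x ^ 2 + a ^ 2) : ℂ) * cexp (-I * ϑ (R x)) * c (R x)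

/-- **Its `r*`-derivative** in closed form:
`e^{-iϑ} [ (r g / s - i s κ / (r² + a²)) c + s g c₁ ]`, `s = √(r² + a²)`, `g = Δ/(r² + a²)`,
`κ = 2Mrω - am`, at `r = R x`. [folklore] -/
def nfU₁ (M a ω : ℝ) (m : ℤ) (R ϑ : ℝ → ℝ) (c c₁ : ℝ → ℂ) (x : ℝ) : ℂ :=
  cexp (-I * ϑ (R x)) *
    (((R x * (delta M a (R x) / (R x ^ 2 + a ^ 2)) / Real.sqrt (R x ^ 2 + a ^ 2) : ℝ) : ℂ) *
        c (R x) -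
      I * ((Real.sqrt (R x ^ 2 + a ^ 2) * (2 * M * R x * ω - a * m) / (R x ^ 2 + a ^ 2) : ℝ) : ℂ) *
        c (R x) +
      ((Real.sqrt (R x ^ 2 + a ^ 2) * (delta M a (R x) / (R x ^ 2 + a ^ 2)) : ℝ) : ℂ) * c₁ (R x))

/-! ### The phase -/

/-- **The phase** `ϑ(r) = ω (t̄(r) - r) - m φ̄(r)` relating `(t*, φ*)`-modes to Boyer–Lindquist
modes, built from the tree's `starTime`/`starAngle`. [folklore] -/
def nfPhase (M a ω : ℝ) (m : ℤ) (r : ℝ) : ℝ :=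
  ω * (starTime M a r - r) - m * starAngle M a r

/-- `ϑ' = (2Mrω - am)/Δ` on `(r₊, ∞)`. [folklore] -/
theorem hasDerivAt_nfPhase {M a : ℝ} (hMa : IsSubextremal M a) (ω : ℝ) (m : ℤ) {r : ℝ}
    (hr : rPlus M a < r) :
    HasDerivAt (nfPhase M a ω m) ((2 * M * r * ω - a * m) / delta M a r) r := by
  have hΔ : delta M a r ≠ 0 := (delta_pos (le_of_lt hMa) hr).ne'
  have h := (((hasDerivAt_starTime hMa hr).sub (hasDerivAt_id r)).const_mul ω).sub
    ((hasDerivAt_starAngle hMa hr).const_mul (m : ℝ))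
  have hfun : nfPhase M a ω m = fun r ↦ ω * (starTime M a r - id r) - m * starAngle M a r := rfl
  rw [hfun]
  refine h.congr_deriv ?_
  field_simp
  rw [delta]
  ring

section Derivation

variable {M a ω lam : ℝ} {m : ℤ} {R ϑ : ℝ → ℝ} {c c₁ c₂ G : ℝ → ℂ} {S : Set ℝ}

/-- **First derivative of `nfU`.** [folklore] -/
theorem hasDerivAt_nfU (hR : IsTortoiseRadius M a R) (hMa : IsSubextremal M a)
    (hϑ : ∀ r ∈ S, HasDerivAt ϑ ((2 * M * r * ω - a * m) / delta M a r) r)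
    (hc : ∀ r ∈ S, HasDerivAt c (c₁ r) r) {x : ℝ} (hx : R x ∈ S) :
    HasDerivAt (nfU a R ϑ c) (nfU₁ M a ω m R ϑ c c₁ x) x := by
  have hp : 0 < R x ^ 2 + a ^ 2 := hR.sq_add_sq_pos hMa x
  have hΔ : 0 < delta M a (R x) := hR.delta_pos hMa x
  have hs : 0 < Real.sqrt (R x ^ 2 + a ^ 2) := Real.sqrt_pos.2 hp
  have hRx := hR.hasDerivAt x
  -- the three factors
  have h1 : HasDerivAt (fun y ↦ (Real.sqrt (R y ^ 2 + a ^ 2) : ℂ))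
      (((2 * R x * (delta M a (R x) / (R x ^ 2 + a ^ 2))) / (2 * Real.sqrt (R x ^ 2 + a ^ 2)) :
        ℝ) : ℂ) x := by
    refine HasDerivAt.ofReal_comp ?_
    have hq : HasDerivAt (fun y ↦ R y ^ 2 + a ^ 2)
        (2 * R x * (delta M a (R x) / (R x ^ 2 + a ^ 2))) x := by
      simpa using (hRx.pow 2).add_const (a ^ 2)
    exact hq.sqrt hp.ne'
  have h2 : HasDerivAt (fun y ↦ cexp (-I * ϑ (R y)))
      (cexp (-I * ϑ (R x)) * (-I * (((2 * M * R x * ω - a * m) / delta M a (R x) *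
        (delta M a (R x) / (R x ^ 2 + a ^ 2)) : ℝ) : ℂ))) x := by
    have hθ : HasDerivAt (fun y ↦ ϑ (R y))
        ((2 * M * R x * ω - a * m) / delta M a (R x) * (delta M a (R x) / (R x ^ 2 + a ^ 2))) x :=
      (hϑ _ hx).comp x hRx
    have hθc := (hθ.ofReal_comp).const_mul (-I)
    refine (hθc.cexp).congr_deriv ?_
    push_cast
    ring
  have h3 : HasDerivAt (fun y ↦ c (R y)) ((delta M a (R x) / (R x ^ 2 + a ^ 2)) • c₁ (R x)) x :=
    (hc _ hx).scomp x hRx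
  have h := (h1.mul h2).mul h3
  refine h.congr_deriv ?_
  simp only [Pi.mul_apply, nfU₁, Complex.real_smul]
  have hsc : (Real.sqrt (R x ^ 2 + a ^ 2) : ℂ) ≠ 0 := by exact_mod_cast hs.ne'
  have hΔc : (delta M a (R x) : ℂ) ≠ 0 := by exact_mod_cast hΔ.ne'
  have hpc : (R x : ℂ) ^ 2 + (a : ℂ) ^ 2 ≠ 0 := by exact_mod_cast hp.ne'
  push_cast
  field_simp
  ring

/-- **DRSR's normal form** `u'' + (ω² - V) u = H` **from the star-chart radial ODE.** Let
`c' = c₁`, `c₁' = c₂`, `ϑ' = (2Mrω - am)/Δ` on a set `S` of radii and let the star-chart ODE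
`Δ c₂ + (2(r - M) + 2i(am - 2Mrω)) c₁ + (ω²(r² + 2Mr) - 2iMω - λ) c = G` hold on `S`. Then at
every `x` with `R x ∈ S`, `u = nfU a R ϑ c` has a second `r*`-derivative `u₂` with
`u₂ + (ω² - V(R x)) u(x) = Δ e^{-iϑ} G / ((r² + a²) √(r² + a²))` at `r = R x`, where
`V = sepPotential M a ω m (λ + a²ω²)`.
[cite: DafermosRodnianskiShlapentokhrothman2014, Prop. 5.2.1 (36)–(38)] -/
theorem nfU_ode (hR : IsTortoiseRadius M a R) (hMa : IsSubextremal M a)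
    (hϑ : ∀ r ∈ S, HasDerivAt ϑ ((2 * M * r * ω - a * m) / delta M a r) r)
    (hc : ∀ r ∈ S, HasDerivAt c (c₁ r) r) (hc₁ : ∀ r ∈ S, HasDerivAt c₁ (c₂ r) r)
    (hode : ∀ r ∈ S, (delta M a r : ℂ) * c₂ r +
      ((2 * (r - M) : ℝ) + 2 * I * (a * m - 2 * M * r * ω)) * c₁ r +
      ((ω ^ 2 * (r ^ 2 + 2 * M * r) : ℝ) - 2 * I * M * ω - lam) * c r = G r)
    {x : ℝ} (hx : R x ∈ S) :
    ∃ u₂ : ℂ, HasDerivAt (nfU₁ M a ω m R ϑ c c₁) u₂ x ∧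
      u₂ + ((ω ^ 2 - sepPotential M a ω m (lam + a ^ 2 * ω ^ 2) (R x) : ℝ) : ℂ) * nfU a R ϑ c x =
        ((delta M a (R x) / ((R x ^ 2 + a ^ 2) * Real.sqrt (R x ^ 2 + a ^ 2)) : ℝ) : ℂ) *
          cexp (-I * ϑ (R x)) * G (R x) := by
  have hp : 0 < R x ^ 2 + a ^ 2 := hR.sq_add_sq_pos hMa x
  have hΔ : 0 < delta M a (R x) := hR.delta_pos hMa x
  have hs : 0 < Real.sqrt (R x ^ 2 + a ^ 2) := Real.sqrt_pos.2 hp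
  have hRx := hR.hasDerivAt x
  -- real building blocks at `r = R x`, as functions of `r`
  have hpr : ∀ r, HasDerivAt (fun r : ℝ ↦ r ^ 2 + a ^ 2) (2 * r) r := fun r ↦ by
    simpa using ((hasDerivAt_id r).pow 2).add_const (a ^ 2)
  have hsr : HasDerivAt (fun r : ℝ ↦ Real.sqrt (r ^ 2 + a ^ 2))
      (2 * R x / (2 * Real.sqrt (R x ^ 2 + a ^ 2))) (R x) := (hpr (R x)).sqrt hp.ne'
  have hκr : HasDerivAt (fun r : ℝ ↦ 2 * M * r * ω - a * m) (2 * M * ω) (R x) := by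
    simpa using (((hasDerivAt_id (R x)).const_mul (2 * M)).mul_const ω).sub_const ((a : ℝ) * m)
  have hgr : HasDerivAt (fun r : ℝ ↦ delta M a r / (r ^ 2 + a ^ 2))
      ((2 * (R x - M) * (R x ^ 2 + a ^ 2) - delta M a (R x) * (2 * R x)) / (R x ^ 2 + a ^ 2) ^ 2)
      (R x) := (hasDerivAt_delta M a (R x)).div (hpr (R x)) hp.ne'
  -- the three real coefficient functions of `nfU₁`, composed with `R`
  have hA := (((((hasDerivAt_id (R x)).mul hgr).div hsr hs.ne').comp x hRx).ofReal_comp :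
    HasDerivAt (fun y ↦ (((fun r : ℝ ↦ id r * (delta M a r / (r ^ 2 + a ^ 2)) /
      Real.sqrt (r ^ 2 + a ^ 2)) (R y) : ℝ) : ℂ)) _ x)
  have hB := ((((hsr.mul hκr).div (hpr (R x)) hp.ne').comp x hRx).ofReal_comp :
    HasDerivAt (fun y ↦ (((fun r : ℝ ↦ Real.sqrt (r ^ 2 + a ^ 2) * (2 * M * r * ω - a * m) /
      (r ^ 2 + a ^ 2)) (R y) : ℝ) : ℂ)) _ x)
  have hD := (((hsr.mul hgr).comp x hRx).ofReal_comp :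
    HasDerivAt (fun y ↦ (((fun r : ℝ ↦ Real.sqrt (r ^ 2 + a ^ 2) *
      (delta M a r / (r ^ 2 + a ^ 2))) (R y) : ℝ) : ℂ)) _ x)
  have hC : HasDerivAt (fun y ↦ c (R y)) ((delta M a (R x) / (R x ^ 2 + a ^ 2)) • c₁ (R x)) x :=
    (hc _ hx).scomp x hRx
  have hC₁ : HasDerivAt (fun y ↦ c₁ (R y)) ((delta M a (R x) / (R x ^ 2 + a ^ 2)) • c₂ (R x)) x :=
    (hc₁ _ hx).scomp x hRx
  have hE : HasDerivAt (fun y ↦ cexp (-I * ϑ (R y)))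
      (cexp (-I * ϑ (R x)) * (-I * (((2 * M * R x * ω - a * m) / delta M a (R x) *
        (delta M a (R x) / (R x ^ 2 + a ^ 2)) : ℝ) : ℂ))) x := by
    have hθ : HasDerivAt (fun y ↦ ϑ (R y))
        ((2 * M * R x * ω - a * m) / delta M a (R x) * (delta M a (R x) / (R x ^ 2 + a ^ 2))) x :=
      (hϑ _ hx).comp x hRx
    have hθc := (hθ.ofReal_comp).const_mul (-I)
    refine (hθc.cexp).congr_deriv ?_
    push_cast
    ring
  have hQ := ((hA.mul hC).sub ((hB.const_mul I).mul hC)).add (hD.mul hC₁)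
  have hU := hE.mul hQ
  have hU' : HasDerivAt (nfU₁ M a ω m R ϑ c c₁) _ x :=
    hU.congr_of_eventuallyEq (Eventually.of_forall fun y ↦ by
      simp only [nfU₁, Pi.mul_apply, Pi.sub_apply, Pi.add_apply, Pi.div_apply,
        Function.comp_apply, id])
  refine ⟨_, hU', ?_⟩
  -- the algebra
  simp only [Pi.mul_apply, Pi.add_apply, Pi.sub_apply, Pi.div_apply, Function.comp_apply, nfU,
    Complex.real_smul, id, sepPotential_eq]
  have hode' := hode _ hx
  set r : ℝ := R x with hr
  set s : ℝ := Real.sqrt (r ^ 2 + a ^ 2) with hsdef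
  have hs2 : r ^ 2 + a ^ 2 = s ^ 2 := (Real.sq_sqrt hp.le).symm
  have ha2 : a ^ 2 = s ^ 2 - r ^ 2 := by linarith
  have hsc : (s : ℂ) ≠ 0 := by exact_mod_cast hs.ne'
  have hδ : delta M a r = s ^ 2 - 2 * M * r := by rw [delta]; linarith
  -- eliminate `c₂` with the ODE and `a²` with `s`
  have hc2 : c₂ r = (G r - ((2 * (r - M) : ℝ) + 2 * I * (a * m - 2 * M * r * ω)) * c₁ r -
      ((ω ^ 2 * (r ^ 2 + 2 * M * r) : ℝ) - 2 * I * M * ω - lam) * c r) / (delta M a r : ℂ) := by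
    have hΔc : (delta M a r : ℂ) ≠ 0 := by exact_mod_cast hΔ.ne'
    rw [← hode', eq_div_iff hΔc]
    ring
  have hΔ2 : (s : ℂ) ^ 2 - 2 * M * r ≠ 0 := by
    have h1 : ((s ^ 2 - 2 * M * r : ℝ) : ℂ) ≠ 0 := by
      rw [← hδ]; exact_mod_cast hΔ.ne'
    push_cast at h1
    exact h1
  have ha2c : (a : ℂ) ^ 2 = (s : ℂ) ^ 2 - (r : ℂ) ^ 2 := by exact_mod_cast ha2
  have hs2c : (s : ℂ) ^ 2 = (r : ℂ) ^ 2 + (a : ℂ) ^ 2 := by exact_mod_cast hs2.symm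
  rw [hc2, hδ]
  push_cast
  rw [ha2c]
  field_simp
  linear_combination ((s : ℂ) ^ 8 * c r * (-4 * r * M * ω * a * m + 4 * r ^ 2 * M ^ 2 * ω ^ 2 +
    a ^ 2 * m ^ 2)) * Complex.I_sq + ((s : ℂ) ^ 8 * c r * m ^ 2) * hs2c

end Derivation

end Kerr

end Literature.Geometry.Lorentzian
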